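import Mathlib
import Summits.CriticalPhenomena.CardyFormulaZ2.Theorems.CardySelfRefinementDefs
import Summits.CriticalPhenomena.CardyFormulaZ2.Theorems.CardySelfRefinementGradientComparabilityStubSlopeBoundsCornerPendant
import Summits.CriticalPhenomena.CardyFormulaZ2.Theorems.CardySelfRefinementGradientComparabilityStubSlopeBoundsCornerPenalty
import HarnessLib

/-!
# Crux `GradientComparability` (stmt-CriticalPhenomena-10269), line `monotone-product-coordinates` —
# stub `stub_cornerLocalSlope` (LOC), penalty bound (A″_k), part 3: a proper pattern of a far bundle
# crosses only through an open interior edge (any `k`), and the defect carries a factor `c`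

Route `CardySelfRefinement`, sub-problem `CriticalPhenomena/CardyFormulaZ2`; vocabulary from
`CardySelfRefinementDefs` (`ax tb M Aloc edgeOf dirVec`); part 1 (`…StubSlopeBoundsCornerPendant`:
`sdiff_mem_Aloc_of_pendant`, a pendant edge is never pivotal), part 2 (`…StubSlopeBoundsCornerPenalty`:
charging and cheap moves), the canonical enumeration `bundle_param_canonical`.

## Mathematics

Let `w j = k t + j e_d` (`j ≤ k`) be the canonical vertices of the bundle `B` of `(t, d)` in
`M_k(ρ,c)` (sub-edges `e_j = {w j, w (j+1)}`, `j < k`), `d' ≠ d`, and at each INTERIOR vertex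
`w j` (`0 < j < k`) let `g⁺_j = edgeOf (w j, d')`, `g⁻_j = edgeOf (w j − e_{d'}, d')` be the two
interior (non-axial: `k ∤ j`) edges.  `E = Aloc m F η`, `A^J = {(ω ∖ B) ∪ J ∈ E}`,
`PIV = A^B ∖ A^∅ = {B set-pivotal}`.

* `defect_subset_open` (registered) — if every interior vertex is drawn `r`-far (`r ≥ 2η`) from
  every quad side, `J ⊊ [k]` and `ω ∈ A^J ∖ A^∅`, then some `g^±_j` is open in `ω`.  Proof by
  induction on `#J` when all `g^±_j` are closed: a nonempty proper `J` has a sub-edge `e_j ∈ J` next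
  to a missing one (`exists_mem_next_notMem`); their common vertex is interior and carries no other
  edge of `(ω ∖ B) ∪ (J ∖ e_j)`, so `e_j` is pendant there and can be removed
  (`sdiff_mem_Aloc_of_pendant`); hence `A^J ⊆ A^{J ∖ e_j} ⊆ … ⊆ A^∅`.
* `defect_le_of_far` (registered) — consequently, for `0 ≤ c < 1` and any `ρ`,

  `M(A^J ∖ A^∅) ≤ c · Σ_{0<j<k} ( 2/(1−c) · M(PIV) + 2^{k+1} · (M(g⁺_j pivotal) + M(g⁻_j pivotal)) )`:

  on `{g open}` (probability `c`, an independent coin) either closing `g` keeps `B` set-pivotal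
  (cost `1/(1−c)`) or `g` is pivotal once `B` is forced open (cost `2^{k+1}`, selector untouched).
* `defect_two_le_of_far` (registered) — the case `k = 2` (one interior vertex, the midpoint).

This is the quantitative half of the penalty bound (A″_k) of the local corner slope bound: summed
over the proper patterns and the bulk bundles, the penalty of the exact dictionary
`∂ρP = (½ − 2^{-k}) N_PIV − 2^{-k} PEN` (`Drho_eq_sum_half_pivotal_sub_defect`) obeys
`PEN_bulk ≤ c · C(k) · (N_PIV/(1−c) + Σ_g M(g pivotal))` with moves uniform in `ρ` (corner-safe); the
remaining half is the transfer `Σ_g M(g pivotal) ≤ C₂ N_PIV` (B″_k) and the boundary layer.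
-/

noncomputable section

namespace Summit.CriticalPhenomena.CardyFormulaZ2.Theorems.CardySelfRefinement

open scoped Topology
open Filter Set MeasureTheory
open Literature.Probability.LatticeModels Literature.Probability.Percolation
open Literature.Probability.Percolation.QuadCrossing
open Summit.CriticalPhenomena.CardyFormulaZ2.Theses.CardySelfRefinement

/-! ## General `k`: a proper pattern crossing needs an open interior edge at an interior vertex -/

/-- The four lattice edges at a vertex `x` of `ℤ²`, sorted by a direction `d` and the other one `d'`. -/
theorem sym2_eq_cases_of_adj {d d' : Fin 2} (hd' : d' ≠ d) {x y : Site 2} (hxy : (zdGraph 2).Adj x y) :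
    s(x, y) = s(x, x + dirVec d) ∨ s(x, y) = s(x - dirVec d, x) ∨
      s(x, y) = s(x, x + dirVec d') ∨ s(x, y) = s(x - dirVec d', x) := by
  have hdv : ∀ i : Fin 2, (dirVec i : Site 2) = Pi.single i 1 := fun i => dirVec_eq_single i
  obtain ⟨i, h | h⟩ := (zdGraph_adj_iff x y).1 hxy
  · rcases fin_two_cases_of_ne hd' i with hi | hi <;> rw [hi] at h
    · exact Or.inl (by rw [h, hdv])
    · exact Or.inr (Or.inr (Or.inl (by rw [h, hdv])))
  · have hy : y = x - Pi.single i 1 := by rw [h, add_sub_cancel_right]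
    rcases fin_two_cases_of_ne hd' i with hi | hi <;> rw [hi] at hy
    · exact Or.inr (Or.inl (by rw [hy, hdv, Sym2.eq_swap]))
    · exact Or.inr (Or.inr (Or.inr (by rw [hy, hdv, Sym2.eq_swap])))

/-- A nonempty proper sub-pattern of `[k]` has an element next to a missing one (inside `[k]`). -/
theorem exists_mem_next_notMem {k : ℕ} {J : Finset ℕ} (hJ : J ⊆ Finset.range k)
    (hJne : J ≠ Finset.range k) (hJ0 : J.Nonempty) :
    ∃ j ∈ J, (j + 1 < k ∧ j + 1 ∉ J) ∨ (0 < j ∧ j - 1 ∉ J) := by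
  by_contra hcon
  push Not at hcon
  obtain ⟨j₁, hj₁⟩ := hJ0
  have hup : ∀ n, j₁ + n < k → j₁ + n ∈ J := by
    intro n
    induction n with
    | zero => exact fun _ => hj₁
    | succ n ih =>
      intro hn
      exact (hcon _ (ih (by omega))).1 (by omega)
  have hdown : ∀ n, j₁ - n ∈ J := by
    intro n
    induction n with
    | zero => exact hj₁
    | succ n ih =>
      by_cases h0 : j₁ - n = 0
      · rwa [show j₁ - (n + 1) = j₁ - n by omega]
      · rw [show j₁ - (n + 1) = j₁ - n - 1 by omega]
        exact (hcon _ ih).2 (by omega)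
  refine hJne (Finset.Subset.antisymm hJ fun i hi => ?_)
  have hik := Finset.mem_range.1 hi
  by_cases h : i ≤ j₁
  · have := hdown (j₁ - i)
    rwa [show j₁ - (j₁ - i) = i by omega] at this
  · have := hup (i - j₁) (by omega)
    rwa [show j₁ + (i - j₁) = i by omega] at this

/-- **Proper patterns of a far bundle need an open interior edge at an interior vertex** (any
`k ≥ 1`; registered helper of `stub_cornerLocalSlope`, the deterministic core of its penalty bound (A″_k)).  Let `w j = k t + j e_d` be the canonical
vertices of the bundle `B` of `(t, d)` (sub-edges `{w j, w (j+1)}`, `j < k`), and suppose every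
INTERIOR vertex `w j`, `0 < j < k`, is drawn at distance `≥ r ≥ 2η` from every quad side.  If
`J ⊊ [k]` and `ω ∈ A^J ∖ A^∅` (the pattern `J` creates the localised crossing on the rest of `ω`),
then at some interior vertex one of the two interior (non-axial) edges `edgeOf (w j, d')`,
`edgeOf (w j − e_{d'}, d')` (`d' ≠ d`) is open in `ω`.  Otherwise, by induction on `#J`: a
nonempty proper pattern has a sub-edge next to a missing one (`exists_mem_next_notMem`); that
sub-edge is pendant at their common (interior) vertex, hence removable (`sdiff_mem_Aloc_of_pendant`). -/
theorem defect_subset_open : ∀ (k m : ℕ), 0 < k → ∀ (F : Fin m → Quad (Set.univ : Set ℂ)) (η r : ℝ), 0 < η → 2 * η ≤ r → ∀ (t : Site 2) (d d' : Fin 2), d' ≠ d → (∀ j : ℕ, 0 < j → j < k → ∀ (i : Fin m) (jj : Fin 4), ∀ p ∈ (F i).side jj, r ≤ dist ((η : ℂ) * squareLatticeEmbedding.z (fun l => (k : ℤ) * t l + if l = d then (j : ℤ) else 0)) p) → ∀ J ∈ (Finset.range k).powerset, J ≠ Finset.range k → {ω | ω \ edgeOf '' {vd : Site 2 × Fin 2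 | ax k vd ∧ tb k vd = t ∧ vd.2 = d} ∪ ↑(J.image fun j : ℕ => edgeOf ((fun l => (k : ℤ) * t l + if l = d then (j : ℤ) else 0), d)) ∈ Aloc m F η} \ {ω | ω \ edgeOf '' {vd : Site 2 × Fin 2 | ax k vd ∧ tb k vd = t ∧ vd.2 = d} ∈ Aloc m F η} ⊆ {ω | ∃ j : ℕ, 0 < j ∧ j < k ∧ (edgeOf ((fun l => (k : ℤ) * t l + if l = d then (j : ℤ) else 0), d') ∈ ω ∨ edgeOf ((fun l => (k : ℤ) * t l + if l = d then (j : ℤ) else 0) - dirVec d', d') ∈ ω)} := by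
  intro k m hk F η r hη hηr t d d' hd' hfar J hJ hJne
  classical
  obtain ⟨hw₁, -, -⟩ := bundle_param_canonical hk t d
  set w : ℕ → Site 2 := fun j l => (k : ℤ) * t l + if l = d then (j : ℤ) else 0 with hw
  set Bset : Set (Sym2 (Site 2)) :=
    edgeOf '' {vd : Site 2 × Fin 2 | ax k vd ∧ tb k vd = t ∧ vd.2 = d} with hBset
  have hdv : (dirVec d : Site 2) = Pi.single d 1 := dirVec_eq_single d
  -- the canonical vertices form a lattice path
  have hsucc : ∀ j : ℕ, w j + dirVec d = w (j + 1) := by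
    intro j
    funext l
    rw [Pi.add_apply, hdv, Pi.single_apply]
    simp only [hw, Nat.cast_succ]
    split_ifs <;> ring
  have hwinj : ∀ j j' : ℕ, w j = w j' → j = j' := by
    intro j j' h
    have h' := congrFun h d
    simp only [hw, if_true, add_right_inj, Nat.cast_inj] at h'
    exact h'
  have hmemB : ∀ j, j < k → edgeOf (w j, d) ∈ Bset := fun j hj =>
    ⟨(w j, d), ⟨(hw₁ j hj).1, (hw₁ j hj).2, rfl⟩, rfl⟩
  have hedge : ∀ j, edgeOf (w j, d) = s(w j, w (j + 1)) := fun j => by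
    show s(w j, w j + dirVec d) = s(w j, w (j + 1))
    rw [hsucc]
  -- pattern sets
  have hmemJ : ∀ (J' : Finset ℕ) (j : ℕ),
      edgeOf (w j, d) ∈ (↑(J'.image fun j : ℕ => edgeOf (w j, d)) : Set (Sym2 (Site 2))) → j ∈ J' := by
    intro J' j h
    rw [Finset.coe_image] at h
    obtain ⟨j', hj', he⟩ := h
    have h := edgeOf_injective he
    rw [Prod.mk.injEq] at h
    rwa [← hwinj _ _ h.1]
  have hperpJ : ∀ (J' : Finset ℕ) (u : Site 2),
      edgeOf (u, d') ∉ (↑(J'.image fun j : ℕ => edgeOf (w j, d)) : Set (Sym2 (Site 2))) := by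
    intro J' u h
    rw [Finset.coe_image] at h
    obtain ⟨j', -, he⟩ := h
    have h := edgeOf_injective he
    rw [Prod.mk.injEq] at h
    exact hd' h.2.symm
  rintro ω ⟨hin, hout⟩
  simp only [Set.mem_setOf_eq] at hin hout ⊢
  by_contra hcon
  push Not at hcon
  -- no edge of `(ω ∖ B) ∪ J'` at an interior vertex whose two sub-edges are off the pattern `J'`
  have hiso : ∀ i : ℕ, 0 < i → i < k → ∀ J' : Finset ℕ, i - 1 ∉ J' → i ∉ J' →
      ∀ y, (zdGraph 2).Adj (w i) y →
        s(w i, y) ∉ ω \ Bset ∪ ↑(J'.image fun j : ℕ => edgeOf (w j, d)) := by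
    intro i hi0 hik J' h1 h2 y hy hmem
    rcases sym2_eq_cases_of_adj hd' hy with h | h | h | h <;> rw [h] at hmem
    · rw [hsucc, ← hedge] at hmem
      rcases hmem with hmem | hmem
      · exact hmem.2 (hmemB i hik)
      · exact h2 (hmemJ J' i hmem)
    · have hpred : w i - dirVec d = w (i - 1) := by
        rw [sub_eq_iff_eq_add, hsucc, Nat.sub_add_cancel hi0]
      have he' : s(w i - dirVec d, w i) = edgeOf (w (i - 1), d) := by
        rw [hedge, Nat.sub_add_cancel hi0, hpred]
      rw [he'] at hmem
      rcases hmem with hmem | hmem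
      · exact hmem.2 (hmemB (i - 1) (by omega))
      · exact h1 (hmemJ J' (i - 1) hmem)
    · rcases hmem with hmem | hmem
      · exact (hcon i hi0 hik).1 hmem.1
      · exact hperpJ J' (w i) hmem
    · have he' : s(w i - dirVec d', w i) = edgeOf (w i - dirVec d', d') := by
        show s(w i - dirVec d', w i) = s(w i - dirVec d', w i - dirVec d' + dirVec d')
        rw [sub_add_cancel]
      rw [he'] at hmem
      rcases hmem with hmem | hmem
      · exact (hcon i hi0 hik).2 hmem.1
      · exact hperpJ J' _ hmem
  -- induction on the size of the proper pattern
  have key : ∀ (n : ℕ) (J' : Finset ℕ), J' ⊆ Finset.range k → J' ≠ Finset.range k → J'.card = n →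
      ω \ Bset ∪ ↑(J'.image fun j : ℕ => edgeOf (w j, d)) ∈ Aloc m F η → ω \ Bset ∈ Aloc m F η := by
    intro n
    induction n with
    | zero =>
      intro J' _ _ hcard h
      rw [Finset.card_eq_zero] at hcard
      subst hcard
      simpa using h
    | succ n ih =>
      intro J' hJ' hJ'ne hcard h
      have hJ'0 : J'.Nonempty := by rw [← Finset.card_pos, hcard]; exact Nat.succ_pos n
      obtain ⟨j, hj, hcase⟩ := exists_mem_next_notMem hJ' hJ'ne hJ'0
      have hjk : j < k := Finset.mem_range.1 (hJ' hj)
      have hsub' : J'.erase j ⊆ Finset.range k := (Finset.erase_subset _ _).trans hJ'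
      have hne' : J'.erase j ≠ Finset.range k := fun h' =>
        Finset.notMem_erase j J' (show j ∈ J'.erase j by rw [h']; exact Finset.mem_range.2 hjk)
      have hcard' : (J'.erase j).card = n := by
        rw [Finset.card_erase_of_mem hj, hcard]
        rfl
      have hsplit : (↑(J'.image fun j : ℕ => edgeOf (w j, d)) : Set (Sym2 (Site 2))) =
          insert (edgeOf (w j, d)) ↑((J'.erase j).image fun j : ℕ => edgeOf (w j, d)) := by
        conv_lhs => rw [← Finset.insert_erase hj]
        rw [Finset.image_insert, Finset.coe_insert]
      have hnotin : edgeOf (w j, d) ∉ ω \ Bset ∪ ↑((J'.erase j).image fun j : ℕ => edgeOf (w j, d)) := by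
        rintro (h' | h')
        · exact h'.2 (hmemB j hjk)
        · exact Finset.notMem_erase j J' (hmemJ _ j h')
      have hin' : insert (edgeOf (w j, d)) (ω \ Bset ∪ ↑((J'.erase j).image fun j : ℕ => edgeOf (w j, d))) ∈
          Aloc m F η := by
        rw [← Set.union_insert, ← hsplit]
        exact h
      refine ih (J'.erase j) hsub' hne' hcard' ?_
      rcases hcase with ⟨hj1k, hj1⟩ | ⟨hj0, hj1⟩
      · -- `e_j` is pendant at the interior vertex `w (j+1)`
        have hadj : (zdGraph 2).Adj (w j) (w (j + 1)) :=
          (zdGraph_adj_iff _ _).2 ⟨d, Or.inl (by rw [← hsucc, hdv])⟩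
        have hiso' := hiso (j + 1) (Nat.succ_pos j) hj1k (J'.erase j)
          (by rw [Nat.add_sub_cancel]; exact Finset.notMem_erase j J')
          (fun h' => hj1 (Finset.mem_of_mem_erase h'))
        have h' := sdiff_mem_Aloc_of_pendant m F hη hηr hadj (fun y hy hmem => absurd hmem (hiso' y hy))
          (hfar (j + 1) (Nat.succ_pos j) hj1k) (by rw [← hedge]; exact hin')
        rwa [← hedge, Set.sdiff_singleton_eq_self hnotin] at h'
      · -- `e_j` is pendant at the interior vertex `w j`
        have hadj : (zdGraph 2).Adj (w (j + 1)) (w j) :=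
          (zdGraph_adj_iff _ _).2 ⟨d, Or.inr (by rw [← hsucc, hdv])⟩
        have hiso' := hiso j hj0 hjk (J'.erase j) (fun h' => hj1 (Finset.mem_of_mem_erase h'))
          (Finset.notMem_erase j J')
        have he : s(w (j + 1), w j) = edgeOf (w j, d) := by rw [Sym2.eq_swap, hedge]
        have h' := sdiff_mem_Aloc_of_pendant m F hη hηr hadj (fun y hy hmem => absurd hmem (hiso' y hy))
          (hfar j hj0 hjk) (by rw [he]; exact hin')
        rwa [he, Set.sdiff_singleton_eq_self hnotin] at h'
  exact hout (key J.card J (Finset.mem_powerset.1 hJ) hJne rfl hin)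

/-! ## The defect of a far bundle carries a factor `c` (any `k`) -/

/-- **Penalty brick of (A″_k) for `stub_cornerLocalSlope`, any `k ≥ 1`** (registered helper).  For a
bundle `(t, d)` of `M_k(ρ,c)` whose interior canonical vertices `w j = k t + j e_d`, `0 < j < k`, are
drawn at distance `≥ r ≥ 2η` from every quad side, `d' ≠ d`, any `ρ` and `0 ≤ c < 1`, the defect of
every proper pattern `J ⊊ [k]` is at most
`c · Σ_{0<j<k} ( 2/(1−c) · M(B set-pivotal) + 2^{k+1} · (M(edgeOf (w j, d') pivotal) + M(edgeOf (w j − e_{d'}, d') pivotal)) )`: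
the interior exit edge is open (`defect_subset_open`, probability `c`, independent of the rest);
closing it either keeps the bundle set-pivotal (cost `1/(1−c)`) or makes it pivotal once the bundle is
forced open by its shared and own coins (cost `2^{k+1}`, selector untouched — uniform in `ρ`). -/
theorem defect_le_of_far : ∀ (k m : ℕ), 0 < k → ∀ (F : Fin m → Quad (Set.univ : Set ℂ)) (η r : ℝ), 0 < η → 2 * η ≤ r → ∀ (t : Site 2) (d d' : Fin 2), d' ≠ d → (∀ j : ℕ, 0 < j → j < k → ∀ (i : Fin m) (jj : Fin 4), ∀ p ∈ (F i).side jj, r ≤ dist ((η : ℂ) * squareLatticeEmbedding.z (fun l => (k : ℤ) * t l + if l = d then (j : ℤ) else 0)) p) → ∀ (ρ c : ℝ), c ∈ Set.Ico (0 : ℝ) 1 → ∀ J ∈ (Finset.range k).powerset, J ≠ Finset.range k → (M k ρ c).real ({ω | ω \ edgeOf '' {vd : Site 2 × Fin 2 | ax k vd ∧ tb k vd = t ∧ vd.2 = d} ∪ ↑(J.image fun j : ℕ => edgeOf ((fun l => (k : ℤ) * t l + if l = d then (j : ℤ) else 0), d)) ∈ Aloc m F η} \ {ω | ω \ edgeOf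 '' {vd : Site 2 × Fin 2 | ax k vd ∧ tb k vd = t ∧ vd.2 = d} ∈ Aloc m F η}) ≤ c * ∑ j ∈ Finset.Ioo 0 k, (2 / (1 - c) * (M k ρ c).real {ω | ω ∪ edgeOf '' {vd : Site 2 × Fin 2 | ax k vd ∧ tb k vd = t ∧ vd.2 = d} ∈ Aloc m F η ∧ ω \ edgeOf '' {vd : Site 2 × Fin 2 | ax k vd ∧ tb k vd = t ∧ vd.2 = d} ∉ Aloc m F η} + 2 ^ (k + 1) * ((M k ρ c).real {ω | IsPivotal (Aloc m F η) (edgeOf ((fun l => (k : ℤ) * t l + if l = d then (j : ℤ) else 0), d')) ω} + (M k ρ c).real {ω | IsPivotal (Aloc m F η) (edgeOf ((fun l => (k : ℤ) * t l + if l = d then (j : ℤ) else 0) - dirVec d', d')) ω})) := by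
  intro k m hk F η r hη hηr t d d' hd' hfar ρ c hc J hJ hJne
  classical
  haveI := isProbabilityMeasure_M k ρ c
  have hsubset := defect_subset_open k m hk F η r hη hηr t d d' hd' hfar J hJ hJne
  obtain ⟨hw₁, -, -⟩ := bundle_param_canonical hk t d
  set w : ℕ → Site 2 := fun j l => (k : ℤ) * t l + if l = d then (j : ℤ) else 0 with hw
  set Bset : Set (Sym2 (Site 2)) :=
    edgeOf '' {vd : Site 2 × Fin 2 | ax k vd ∧ tb k vd = t ∧ vd.2 = d} with hBset
  set E : Set (BondConfig (Site 2)) := Aloc m F η with hE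
  set PIV : Set (BondConfig (Site 2)) := {ω | ω ∪ Bset ∈ E ∧ ω \ Bset ∉ E} with hPIV
  set Jset : Set (Sym2 (Site 2)) := ↑(J.image fun j : ℕ => edgeOf (w j, d)) with hJset
  set DEF : Set (BondConfig (Site 2)) := {ω | ω \ Bset ∪ Jset ∈ E} \ {ω | ω \ Bset ∈ E} with hDEF
  have hEu : IsUpperSet E := isUpperSet_Aloc m F η
  have hEm : MeasurableSet E := measurableSet_Aloc m F hη.ne'
  have hdv : ∀ i : Fin 2, (dirVec i : Site 2) = Pi.single i 1 := fun i => dirVec_eq_single i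
  -- the interior edges at interior vertices are non-axial and outside the bundle
  have hcoord : (if d' = 0 then (1 : Fin 2) else 0) = d := by
    fin_cases d <;> fin_cases d' <;> simp_all
  have hwd : ∀ j : ℕ, w j d = k * t d + j := fun j => by simp [hw]
  have hndvd : ∀ j : ℕ, 0 < j → j < k → ¬ (k : ℤ) ∣ k * t d + j := by
    intro j hj0 hjk h
    have h' : (k : ℤ) ∣ (j : ℤ) := by
      obtain ⟨q, hq⟩ := h
      exact ⟨q - t d, by rw [mul_sub]; linarith⟩
    have := Int.le_of_dvd (by exact_mod_cast hj0) h'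
    omega
  have haxp : ∀ j : ℕ, 0 < j → j < k → ¬ ax k (w j, d') := by
    intro j hj0 hjk
    show ¬ (k : ℤ) ∣ w j (if d' = 0 then 1 else 0)
    rw [hcoord, hwd]
    exact hndvd j hj0 hjk
  have haxm : ∀ j : ℕ, 0 < j → j < k → ¬ ax k (w j - dirVec d', d') := by
    intro j hj0 hjk
    show ¬ (k : ℤ) ∣ (w j - dirVec d') (if d' = 0 then 1 else 0)
    rw [hcoord, Pi.sub_apply, hdv, Pi.single_apply, if_neg (Ne.symm hd'), hwd, sub_zero]
    exact hndvd j hj0 hjk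
  have hnotB : ∀ u : Site 2, edgeOf (u, d') ∉ Bset := by
    rintro u ⟨vd, ⟨-, -, h2⟩, he⟩
    have h := edgeOf_injective he
    subst h
    exact hd' h2
  have hJB : Jset ⊆ Bset := by
    intro e he
    rw [hJset, Finset.coe_image] at he
    obtain ⟨j, hj, rfl⟩ := he
    have hj2 : j < k := Finset.mem_range.1 (Finset.mem_powerset.1 hJ (Finset.mem_coe.1 hj))
    exact ⟨(w j, d), ⟨(hw₁ j hj2).1, (hw₁ j hj2).2, rfl⟩, rfl⟩
  have hPIVm : MeasurableSet PIV :=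
    ((measurable_set_iff.2 fun x => (measurable_set_mem x).or measurable_const :
        Measurable fun ω : BondConfig (Site 2) => ω ∪ Bset) hEm).inter
      ((measurable_set_iff.2 fun x => (measurable_set_mem x).and measurable_const :
        Measurable fun ω : BondConfig (Site 2) => ω \ Bset) hEm).compl
  -- one interior edge
  have key : ∀ u : Site 2, ¬ ax k (u, d') →
      (M k ρ c).real (DEF ∩ {ω | edgeOf (u, d') ∈ ω}) ≤
        c / (1 - c) * (M k ρ c).real PIV + 2 ^ (k + 1) * c * (M k ρ c).real {ω | IsPivotal E (edgeOf (u, d')) ω} := by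
    intro u hax
    set g : Sym2 (Site 2) := edgeOf (u, d') with hg
    set E₂ : Set (BondConfig (Site 2)) := {ω' | IsPivotal E g (ω' ∪ Bset)} with hE₂
    have hp : (prm k ρ c (u, d', 0) : ℝ) = c := by
      simp [prm, hax, Set.projIcc_of_mem _ (Set.Ico_subset_Icc_self hc)]
    have hPivm : MeasurableSet {ω : BondConfig (Site 2) | IsPivotal E g ω} := measurableSet_setOf_isPivotal hEm g
    have hE₂m : MeasurableSet E₂ :=
      (measurable_set_iff.2 fun x => (measurable_set_mem x).or measurable_const :
        Measurable fun ω : BondConfig (Site 2) => ω ∪ Bset) hPivm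
    have hE₂eq : {ω : BondConfig (Site 2) | ω \ {g} ∈ E₂} = E₂ := by
      ext ω
      simp only [hE₂, Set.mem_setOf_eq]
      rw [show ω \ {g} ∪ Bset = (ω ∪ Bset) \ {g} by
        rw [Set.union_sdiff_distrib, Set.sdiff_singleton_eq_self (hnotB u)], isPivotal_sdiff_singleton_iff]
    have h1 : (M k ρ c).real {ω | ω \ {g} ∈ PIV} ≤ 1 / (1 - c) * (M k ρ c).real PIV := by
      have h := one_sub_mul_real_sdiff_mem_le k hax ρ c hPIVm
      rw [hp] at h
      rw [one_div, ← div_eq_inv_mul, le_div_iff₀ (by linarith [hc.2])]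
      linarith
    have h2 : (M k ρ c).real E₂ ≤ 2 ^ (k + 1) * (M k ρ c).real {ω | IsPivotal E g ω} :=
      real_isPivotal_union_bundle_le k m hk F hη.ne' ρ c t d g
    calc (M k ρ c).real (DEF ∩ {ω | g ∈ ω})
        ≤ (M k ρ c).real ({ω | g ∈ ω ∧ ω \ {g} ∈ PIV} ∪ {ω | g ∈ ω ∧ ω \ {g} ∈ E₂}) :=
          measureReal_mono (defect_inter_subset hEu hJB (hnotB u))
      _ ≤ (M k ρ c).real {ω | g ∈ ω ∧ ω \ {g} ∈ PIV} + (M k ρ c).real {ω | g ∈ ω ∧ ω \ {g} ∈ E₂} :=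
          measureReal_union_le _ _
      _ = c * (M k ρ c).real {ω | ω \ {g} ∈ PIV} + c * (M k ρ c).real {ω | ω \ {g} ∈ E₂} := by
          rw [hg, real_mem_and_sdiff_mem_eq k hax ρ c hPIVm, real_mem_and_sdiff_mem_eq k hax ρ c hE₂m, hp]
      _ ≤ c * (1 / (1 - c) * (M k ρ c).real PIV) + c * (2 ^ (k + 1) * (M k ρ c).real {ω | IsPivotal E g ω}) := by
          rw [hE₂eq]
          gcongr
          · exact hc.1
          · exact hc.1
      _ = c / (1 - c) * (M k ρ c).real PIV + 2 ^ (k + 1) * c * (M k ρ c).real {ω | IsPivotal E g ω} := by ring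
  -- all interior edges at interior vertices
  have hcover : DEF ⊆ ⋃ j ∈ Finset.Ioo 0 k,
      (DEF ∩ {ω | edgeOf (w j, d') ∈ ω} ∪ DEF ∩ {ω | edgeOf (w j - dirVec d', d') ∈ ω}) := by
    intro ω hω
    obtain ⟨j, hj0, hjk, h⟩ := hsubset hω
    refine Set.mem_iUnion₂.2 ⟨j, Finset.mem_Ioo.2 ⟨hj0, hjk⟩, ?_⟩
    rcases h with h | h
    · exact Or.inl ⟨hω, h⟩
    · exact Or.inr ⟨hω, h⟩
  calc (M k ρ c).real DEF
      ≤ (M k ρ c).real (⋃ j ∈ Finset.Ioo 0 k,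
          (DEF ∩ {ω | edgeOf (w j, d') ∈ ω} ∪ DEF ∩ {ω | edgeOf (w j - dirVec d', d') ∈ ω})) :=
        measureReal_mono hcover (measure_ne_top _ _)
    _ ≤ ∑ j ∈ Finset.Ioo 0 k,
          (M k ρ c).real (DEF ∩ {ω | edgeOf (w j, d') ∈ ω} ∪ DEF ∩ {ω | edgeOf (w j - dirVec d', d') ∈ ω}) :=
        measureReal_biUnion_finset_le _ _
    _ ≤ ∑ j ∈ Finset.Ioo 0 k,
          ((c / (1 - c) * (M k ρ c).real PIV + 2 ^ (k + 1) * c * (M k ρ c).real {ω | IsPivotal E (edgeOf (w j, d')) ω}) +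
            (c / (1 - c) * (M k ρ c).real PIV +
              2 ^ (k + 1) * c * (M k ρ c).real {ω | IsPivotal E (edgeOf (w j - dirVec d', d')) ω})) := by
        refine Finset.sum_le_sum fun j hj => ?_
        obtain ⟨hj0, hjk⟩ := Finset.mem_Ioo.1 hj
        exact (measureReal_union_le _ _).trans
          (add_le_add (key (w j) (haxp j hj0 hjk)) (key (w j - dirVec d') (haxm j hj0 hjk)))
    _ = c * ∑ j ∈ Finset.Ioo 0 k, (2 / (1 - c) * (M k ρ c).real PIV +
          2 ^ (k + 1) * ((M k ρ c).real {ω | IsPivotal E (edgeOf (w j, d')) ω} +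
            (M k ρ c).real {ω | IsPivotal E (edgeOf (w j - dirVec d', d')) ω})) := by
        rw [Finset.mul_sum]
        refine Finset.sum_congr rfl fun j _ => ?_
        ring

/-! ## The case `k = 2`: the two interior edges at the midpoint -/

/-- **Penalty brick of (A″₂)** (registered helper of `stub_cornerLocalSlope`; the case `k = 2` of
`defect_le_of_far`, whose only interior vertex is the midpoint `v = 2t + e_d`): for a bundle of
`M_2(ρ,c)` whose midpoint is drawn at distance `≥ r ≥ 2η` from every quad side, `d' ≠ d`, any `ρ`
and `0 ≤ c < 1`, the defect of every proper pattern `J ⊊ [2]` — the negative terms `SIDE₁₀`,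
`SIDE₀₁` of the `k = 2` dictionary `∂ρP = ¼ N_PIV − ¼ PEN` (`Drho_two_eq_quarter_piv_sub_side`) — is
at most `c · ( 2/(1−c) · M(B set-pivotal) + 8 · (M(g₊ pivotal) + M(g₋ pivotal)) )`, `g₊ = edgeOf (v, d')`,
`g₋ = edgeOf (v − e_{d'}, d')`.  Summed over the bulk bundles: `PEN_bulk ≤ (c/(1−c)) (4 N_PIV + 16 (1−c) Σ_g M(g pivotal))`. -/
theorem defect_two_le_of_far : ∀ (k m : ℕ), k = 2 → ∀ (F : Fin m → Quad (Set.univ : Set ℂ)) (η r : ℝ), 0 < η → 2 * η ≤ r → ∀ (t : Site 2) (d d' : Fin 2), d' ≠ d → (∀ (i : Fin m) (j : Fin 4), ∀ p ∈ (F i).side j, r ≤ dist ((η : ℂ) * squareLatticeEmbedding.z (fun l => (k : ℤ) * t l + if l = d then 1 else 0)) p) → ∀ (ρ c : ℝ), c ∈ Set.Ico (0 : ℝ) 1 → ∀ J ∈ (Finset.range k).powerset, J ≠ Finset.range k → (M k ρ c).real ({ω | ω \ edgeOf '' {vd : Site 2 × Fin 2 | ax k vd ∧ tb k vd = t ∧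 vd.2 = d} ∪ ↑(J.image fun j : ℕ => edgeOf ((fun l => (k : ℤ) * t l + if l = d then (j : ℤ) else 0), d)) ∈ Aloc m F η} \ {ω | ω \ edgeOf '' {vd : Site 2 × Fin 2 | ax k vd ∧ tb k vd = t ∧ vd.2 = d} ∈ Aloc m F η}) ≤ c * (2 / (1 - c) * (M k ρ c).real {ω | ω ∪ edgeOf '' {vd : Site 2 × Fin 2 | ax k vd ∧ tb k vd = t ∧ vd.2 = d} ∈ Aloc m F η ∧ ω \ edgeOf '' {vd : Site 2 × Fin 2 | ax k vd ∧ tb k vd = t ∧ vd.2 = d} ∉ Aloc m F η} + 8 * ((M k ρ c).real {ω | IsPivotal (Aloc m F η) (edgeOf ((fun l => (k : ℤ) * t l + if l = d then 1 else 0), d')) ω} + (M k ρ c).real {ω | IsPivotal (Aloc m F η) (edgeOf ((fun l => (k : ℤ) * t l + if l = d then 1 else 0) - dirVec d', d')) ω})) := by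
  intro k m hk F η r hη hηr t d d' hd' hfar ρ c hc J hJ hJne
  subst hk
  have hfar' : ∀ j : ℕ, 0 < j → j < 2 → ∀ (i : Fin m) (jj : Fin 4), ∀ p ∈ (F i).side jj,
      r ≤ dist ((η : ℂ) * squareLatticeEmbedding.z (fun l => ((2 : ℕ) : ℤ) * t l + if l = d then (j : ℤ) else 0)) p := by
    intro j hj0 hj2
    obtain rfl : j = 1 := by omega
    simpa only [Nat.cast_one] using hfar
  have h := defect_le_of_far 2 m two_pos F η r hη hηr t d d' hd' hfar' ρ c hc J hJ hJne
  have hIoo : Finset.Ioo 0 2 = {1} := by decide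
  rw [hIoo, Finset.sum_singleton] at h
  simp only [Nat.cast_one] at h
  rw [show ((2 : ℝ) ^ (2 + 1)) = 8 by norm_num] at h
  exact h
end Summit.CriticalPhenomena.CardyFormulaZ2.Theorems.CardySelfRefinement

end
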